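import Literature.Analysis.FluidPDE.FracNSGalerkinEnergy
import Literature.Analysis.FluidPDE.FracNSGalerkinWeakForm
import HarnessLib

/-!
# Fractional Navier–Stokes on `𝕋³`: the limit of a fractional Galerkin scheme is a Leray solution —
  discharge of the named fact `fracGalerkin_limit` (part 5 of 5, assembly)

Analysis/FluidPDE. Final module of the proof of the named fact
`Literature.Analysis.FluidPDE.fracGalerkin_limit` (`Literature/Analysis/FluidPDE/FracNSGalerkin`;
Colombo–De Lellis–De Rosa 2018, §9, proof of Thm. 1.1, second half: the strong `L²_loc` limit of
the Galerkin approximations `w_K` "is a Leray solution", i.e. a distributional solution of the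
Cauchy problem on `T³ × ℝ⁺` in `L^∞(ℝ⁺, L²) ∩ L²(ℝ⁺, H^α)` satisfying the energy inequalities
(2) and (3) of §1), assembling the parts

* `FracNSGalerkinCompactness` — bounds, modulus of continuity, extraction, limit coefficients;
* `FracNSGalerkinLimitField` — the limit field, Fatou for the dissipation, Friedrichs;
* `FracNSGalerkinEnergy` — energy inequalities (2), (3) in `[0, ∞]`, the energy class;
* `FracNSGalerkinWeakForm` — the weak form of the equations on every `(0, T)`

into the clauses of `Torus.IsLerayFracSolution α u₀ u` (`Literature/Analysis/FluidPDE/FractionalNSTorus`):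
the global-in-time weak formulation with datum (`Torus.IsWeakFracNSSolutionWithData α 1 u₀ u`,
from the `(0, T)` identity with `T` beyond the time support of the test field), the `L^∞L²`
bound, `L²(0,T; H^α)` for every `T`, (2) for every `t ≥ 0` and (3) from a.e. `s > 0`.

Main results: `IsFracGalerkinScheme.isLerayFracSolution_limit` and
`IsFracGalerkinScheme.exists_isLerayFracSolution` (general dimension `d`, every `α > 0`), and the
discharge `fracGalerkin_limit_holds : fracGalerkin_limit` (`d = 3`, `0 < α < 1` as printed; the
upper bound on `α` is not used). Theorem-only module.

## References

* M. Colombo, C. De Lellis, L. De Rosa, *Ill-posedness of Leray solutions for the hypodissipative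
  Navier–Stokes equations*, Comm. Math. Phys. 362 (2018), 659–688 (arXiv:1708.05666), §1 Thm. 1.1,
  (2)–(3) and the weak formulation; §9 (proof of Thm. 1.1, p. 20). [`ColomboDelellisDerosa2018`]
* J. C. Robinson, J. L. Rodrigo, W. Sadowski, *The three-dimensional Navier–Stokes equations*
  (CUP 2016), Thm. 4.4 (the `α = 1` template of the tree). [`RobinsonRodrigoSadowski2016`]
-/

noncomputable section

open MeasureTheory TopologicalSpace Set Function Filter Topology UnitAddTorus
open scoped InnerProductSpace RealInnerProductSpace ENNReal NNReal

namespace Literature.Analysis.FluidPDE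

variable {d : Type*} [Fintype d] [DecidableEq d]

variable {α : ℝ} {u₀ : UnitAddTorus d → EuclideanSpace ℝ d} {N : ℕ → ℕ}
  {U : ℕ → ℝ → UnitAddTorus d → EuclideanSpace ℝ d}
  {u : ℝ → UnitAddTorus d → EuclideanSpace ℝ d}

/-! ## The global weak formulation with datum -/

/-- **The weak formulation with datum on `T^d × [0, ∞)` for the limit** (CDLDR 2018, §1:
`∫₀^∞∫ [(∂ₜ - (-Δ)^α)φ·v + Dφ : v⊗v] = -∫ v̄·φ(·,0)` for every smooth divergence-free `φ` with
compact support in time): for a test field `ψ` with `IsSpaceTimeTest T' ψ` for some `T'`, apply the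
`(0, T)` identity `IsFracGalerkinScheme.weak_form_limit` with `T = max T' 1`; the integrand
vanishes for `t ≥ T` (there `ψ t = 0` and `∂ₜψ t = 0`), so the integral over `(0, ∞)` is the
integral over `(0, T)`. [cite: ColomboDelellisDerosa2018, §1 (weak formulation) and §9] -/
theorem IsFracGalerkinScheme.weak_form_limit_Ioi (hS : IsFracGalerkinScheme α u₀ N U)
    (hα : 0 < α) (hu₀ : MemLp u₀ 2 volume)
    (hum : AEStronglyMeasurable (FunctionSpaces.Torus.stLift u) (volume.restrict (Ioi 0 ×ˢ univ)))
    (hu : ∀ t, 0 ≤ t → MemLp (u t) 2 volume)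
    (hc : ∀ t, 0 ≤ t → ∀ k, Tendsto (fun n => mFourierCoeff (FunctionSpaces.EuclideanSpace.complexify ∘ U n t) k)
      atTop (𝓝 (mFourierCoeff (FunctionSpaces.EuclideanSpace.complexify ∘ u t) k)))
    (ψ : ℝ → UnitAddTorus d → EuclideanSpace ℝ d) (hψ : ∃ T' : ℝ, FunctionSpaces.Torus.IsSpaceTimeTest T' ψ)
    (hdiv : FunctionSpaces.Torus.IsDivFreeTest ψ) :
    (∫ t in Ioi 0, ∫ x, (⟪u t x, FunctionSpaces.Torus.timeDeriv ψ t x⟫ + ⟪u t x, FunctionSpaces.Torus.convect (u t) (ψ t) x⟫ -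
        1 * ⟪u t x, Torus.fracLaplacian α (ψ t) x⟫)) + ∫ x, ⟪u₀ x, ψ 0 x⟫ = 0 := by
  obtain ⟨T', hψ'⟩ := hψ
  set T : ℝ := max T' 1 with hTdef
  have hT : 0 < T := lt_of_lt_of_le one_pos (le_max_right _ _)
  have hψT : FunctionSpaces.Torus.IsSpaceTimeTest T ψ := hψ'.of_le (le_max_left _ _)
  have hkey := hS.weak_form_limit hα hu₀ hum hu hc hT hψT hdiv
  -- the integrand vanishes for `t ≥ T`
  obtain ⟨T₁, hT₁, h₁⟩ := hψT.2
  obtain ⟨T₂, hT₂, h₂⟩ := hψT.timeDeriv.2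
  have hzero : ∀ t, T ≤ t → (∫ x, (⟪u t x, FunctionSpaces.Torus.timeDeriv ψ t x⟫ +
      ⟪u t x, FunctionSpaces.Torus.convect (u t) (ψ t) x⟫ - 1 * ⟪u t x, Torus.fracLaplacian α (ψ t) x⟫)) = 0 := by
    intro t ht
    have e1 : ψ t = 0 := h₁ t (hT₁.le.trans ht)
    have e2 : FunctionSpaces.Torus.timeDeriv ψ t = 0 := h₂ t (hT₂.le.trans ht)
    simp [e1, e2, Torus.convect_pi_zero_right, Torus.fracLaplacian_zero_fun]
  have hIoi : (∫ t in Ioi 0, ∫ x, (⟪u t x, FunctionSpaces.Torus.timeDeriv ψ t x⟫ +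
      ⟪u t x, FunctionSpaces.Torus.convect (u t) (ψ t) x⟫ - 1 * ⟪u t x, Torus.fracLaplacian α (ψ t) x⟫)) =
      ∫ t in Ioo 0 T, ∫ x, (⟪u t x, FunctionSpaces.Torus.timeDeriv ψ t x⟫ +
      ⟪u t x, FunctionSpaces.Torus.convect (u t) (ψ t) x⟫ - 1 * ⟪u t x, Torus.fracLaplacian α (ψ t) x⟫) := by
    refine setIntegral_eq_of_subset_of_forall_sdiff_eq_zero measurableSet_Ioi Ioo_subset_Ioi_self
      fun t ht => hzero t ?_
    by_contra hlt
    exact ht.2 ⟨ht.1, lt_of_not_ge hlt⟩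
  rw [hIoi]
  exact hkey

/-- **The limit is a weak solution with datum on `[0, ∞)`** (`Torus.IsWeakFracNSSolutionWithData α 1 u₀ u`):
space–time measurability, local square integrability, weak incompressibility at every `t ≥ 0`,
and the weak formulation with datum. [cite: ColomboDelellisDerosa2018, §1 (weak formulation) and §9] -/
theorem IsFracGalerkinScheme.isWeakFracNSSolutionWithData_limit (hS : IsFracGalerkinScheme α u₀ N U)
    (hα : 0 < α) (hu₀ : MemLp u₀ 2 volume)
    (hum : AEStronglyMeasurable (FunctionSpaces.Torus.stLift u) (volume.restrict (Ioi 0 ×ˢ univ)))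
    (hu : ∀ t, 0 ≤ t → MemLp (u t) 2 volume)
    (hc : ∀ t, 0 ≤ t → ∀ k, Tendsto (fun n => mFourierCoeff (FunctionSpaces.EuclideanSpace.complexify ∘ U n t) k)
      atTop (𝓝 (mFourierCoeff (FunctionSpaces.EuclideanSpace.complexify ∘ u t) k))) :
    Torus.IsWeakFracNSSolutionWithData α 1 u₀ u := by
  refine ⟨hum, fun T => hS.lintegral_limit_lt_top hu₀ hu hc T, ?_, fun ψ hψ hψdiv => ?_⟩
  · filter_upwards [ae_restrict_mem measurableSet_Ioi] with t ht
    exact hS.isWeaklyDivFree_limit hu hc (le_of_lt ht)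
  · exact hS.weak_form_limit_Ioi hα hu₀ hum hu hc ψ hψ hψdiv

/-! ## Assembly -/

/-- **A coefficientwise limit of a fractional Galerkin scheme is a Leray solution of the
fractional Navier–Stokes system** (Colombo–De Lellis–De Rosa 2018, Thm. 1.1 via §9; every
`α > 0`, general dimension): the five clauses of `Torus.IsLerayFracSolution` for a field `u` with
`L²` slices, a.e. strongly measurable on `(0, ∞) × T^d`, to which the approximations converge
coefficientwise at every time. [cite: ColomboDelellisDerosa2018, §9 (proof of Thm. 1.1)] -/
theorem IsFracGalerkinScheme.isLerayFracSolution_limit (hS : IsFracGalerkinScheme α u₀ N U)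
    (hα : 0 < α) (hu₀ : MemLp u₀ 2 volume) (hdiv : FunctionSpaces.Torus.IsWeaklyDivFree u₀)
    (hum : AEStronglyMeasurable (FunctionSpaces.Torus.stLift u) (volume.restrict (Ioi 0 ×ˢ univ)))
    (hu : ∀ t, 0 ≤ t → MemLp (u t) 2 volume)
    (hc : ∀ t, 0 ≤ t → ∀ k, Tendsto (fun n => mFourierCoeff (FunctionSpaces.EuclideanSpace.complexify ∘ U n t) k)
      atTop (𝓝 (mFourierCoeff (FunctionSpaces.EuclideanSpace.complexify ∘ u t) k))) :
    Torus.IsLerayFracSolution α u₀ u :=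
  ⟨hS.isWeakFracNSSolutionWithData_limit hα hu₀ hum hu hc,
    hS.exists_eL2NormSq_limit_le hu₀ hu hc,
    fun T _ => hS.memL2Sobolev_limit hα hu₀ hum hu hc T,
    fun _ ht => hS.fracEnergyIneq_zero_limit hα.ne' hu₀ hdiv hum hu hc ht,
    hS.fracEnergyIneq_ae_limit hα hu₀ hum hu hc⟩

/-- **Every fractional Galerkin scheme has a subsequence converging to a Leray solution**
(Colombo–De Lellis–De Rosa 2018, §9, second half of the proof of Thm. 1.1; general dimension `d`,
every `α > 0`): the limit field of `exists_limitField` along the extracted subsequence is a Leray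
solution of the fractional Navier–Stokes system with datum `u₀`.
[cite: ColomboDelellisDerosa2018, §9 (proof of Thm. 1.1)] -/
theorem IsFracGalerkinScheme.exists_isLerayFracSolution (hS : IsFracGalerkinScheme α u₀ N U)
    (hα : 0 < α) (hu₀ : MemLp u₀ 2 volume) (hdiv : FunctionSpaces.Torus.IsWeaklyDivFree u₀) :
    ∃ u : ℝ → UnitAddTorus d → EuclideanSpace ℝ d, Torus.IsLerayFracSolution α u₀ u := by
  obtain ⟨φ, hφ, u, hum, hu, hc⟩ := hS.exists_limitField hu₀
  exact ⟨u, (hS.comp_strictMono hφ).isLerayFracSolution_limit hα hu₀ hdiv hum hu hc⟩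

/-- **Discharge of the named fact `fracGalerkin_limit`** (Colombo–De Lellis–De Rosa 2018, §9,
proof of Thm. 1.1, second half: uniform bounds, extraction, strong `L²_loc` convergence, "which
would show that `v` is a Leray solution"; §1 Thm. 1.1 and (2)–(3)): on `𝕋³`, for `0 < α < 1`
and weakly divergence-free `u₀ ∈ L²`, every fractional Galerkin scheme for `(α, u₀)` yields a
Leray solution `Torus.IsLerayFracSolution α u₀ u`.
[cite: ColomboDelellisDerosa2018, §9 (proof of Thm. 1.1) and §1 Thm. 1.1, (2)–(3)] -/
theorem fracGalerkin_limit_holds : fracGalerkin_limit :=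
  fun _α hα _hα1 _u₀ hu₀ hdiv _N _U hS => hS.exists_isLerayFracSolution hα hu₀ hdiv

end Literature.Analysis.FluidPDE
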